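import Summits.ResolutionOfSingularities.ResolutionOfSingularities.Theorems.PurelyInseparableDim4E2OfCJSIsolation
import Summits.ResolutionOfSingularities.ResolutionOfSingularities.Theorems.PurelyInseparableDim4E2OfCJSRowsPrime
import Summits.ResolutionOfSingularities.ResolutionOfSingularities.Theorems.PurelyInseparableDim4E2OfCJSSettingPrime
import HarnessLib

/-!
# F4-I(p,p) from CJS — row (I_p): the closed point of a local scheme presented by `z^p + F` with an ISOLATED
# `p`-fold point is isolated in its Hilbert–Samuel locus — EVERY exponent `p ≥ 1`, every field (cell `res-dim4-pi`,
# p-program of desk WORD #66)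

[OURS · counted 0 · AI work weaker than expert review.]  Cell `res-dim4-pi` (D-0157 DOOR 2), seat `res-dim4-p-11` g2
(row (I_p) hand; holder res-dim4-p-2 g2).  NOTHING here proves `NoWideTrap p p`, the Cossart–Jannsen–Saito theorem, or
resolution of singularities in dimension ≥ 4 / characteristic `p`.

The p = 3 file `…E2OfCJSIsolation` (p666809) used `3` only through numerals and through res-dim4-p-2 g2's `p = 3`
abbreviations `hypGerm` / `HypStalk` / `PresentedBy`.  This file is its VERBATIM generalisation with the germ
`gₚ = (z^p + F)_0 = Prime.hypGerm L p F` written out (def-free), for every `p ≠ 0` and every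
field `L` — no primality, no characteristic, no perfectness:

* §1 the quotient `𝒪_{𝔸⁵,0} ⧸ (gₚ)` is local (germ facts from `…E2OfCJSSettingPrime`);
* §2 the prime dictionary and the stalks `𝒪_{Spec B, 𝔮} ≅ L[z,x]_Q ⧸ (z^p + F)` (`B = 𝒪_{𝔸⁵,0} ⧸ (gₚ)`), reusing the
  p-free lemmas of `…E2OfCJSIsolation` (§2–§3 there);
* §3 **`exists_hsFun_eq`** — Bennett at every point: `H^N(𝔮) = hypersurfaceHFe (N+1) m`, `1 ≤ m ≤ p` the symbolic
  order of `z^p + F` at the contracted prime (ORDER CAP `SymbolicPower.hyp_not_mem_symbPow_succ`, any `p`);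
* §4 **`isIsolatedInHSMaxLocus_closedPoint`** (`ordZero F = p`, `IsIsolated p F`, `N ≥ 4`) and
  **`isolationRowP_unfolded`**: for ANY scheme `S` local at `s` with `𝒪_{S,s} ≃+* 𝒪_{𝔸⁵_L,0} ⧸ (gₚ)`, the point `s` is
  isolated in the Hilbert–Samuel locus of `S` at every level `N ≥ 4` — the δ-unfolded row (I_p); and BY NAME
  **`E2OfCJS.isolationRowP (p) [Fact p.Prime] : IsolationRowP p`** (res-dim4-p-3 g2's `…E2OfCJSRowsPrime`).

bears_on: LADDER-RESOLUTION:D157-DOOR2 (res-dim4-pi · p-program · row (I_p)).  Supports stmt-ResolutionOfSingularities-16155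
(helper).

## References

* V. Cossart, U. Jannsen, S. Saito, LNM 2270 (2020): Def. 2.28, Def. 2.35, Thm. 2.3 (Bennett), Def. 13.3. [CossartJannsenSaito2020]
* H. Matsumura, Commutative Ring Theory (1986), §6 / Thm. 4.1 (symbolic powers). [Matsumura1987]
* The Stacks Project, Tag 01J7. [StacksProject]
-/

set_option linter.dupNamespace false -- mandated namespace of this single-conjunct summit

noncomputable section

open CategoryTheory AlgebraicGeometry TopologicalSpace IsLocalRing
open Literature.AlgebraicGeometry.Resolution Literature.RingTheory.HilbertSamuel
open Literature.AlgebraicGeometry.Resolution.Hauser2010 (ordZero one_le_ordZero_iff)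
open Literature.AlgebraicGeometry.CossartJannsenSaito2020
open Literature.AlgebraicGeometry.Resolution.AffinePointBlowup (A P ξ)
open Literature.AlgebraicGeometry.Hironaka2017.SpecOrders (Zs St)
open Summit.ResolutionOfSingularities.ResolutionOfSingularities.Theorems.SigmaMaxModificationsCorridor3.Helpers
  (hypersurfaceHFe hsFun_eq_hypersurfaceHFe_of_stalk_ringEquiv)
open Summit.ResolutionOfSingularities.ResolutionOfSingularities.Theorems.SigmaMaxModificationsCorridor3.Moving.LocalChains
  (isIsolatedInHSMaxLocus_of_iso specializes_of_isLocalAt)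
open Summit.ResolutionOfSingularities.ResolutionOfSingularities.Cruxes.SigmaMaxModifications.IdeasL1C4
  (exists_ringEquiv_localization_quotient)

universe u

namespace Summit.ResolutionOfSingularities.ResolutionOfSingularities.Theorems.PIDim4

namespace E2OfCJS

namespace IsolationP

variable {L : Type} [Field L] {p : ℕ}

/-! ## §1 The germ `gₚ = (z^p + F)_0` -/

/-- `𝒪_{𝔸⁵,0} ⧸ (gₚ)` is a local ring. [folklore] -/
theorem isLocalRing_quot (hp : p ≠ 0) (F : MvPolynomial (Fin 4) L) (hF : MvPolynomial.constantCoeff F = 0) :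
    IsLocalRing (originStalk L ⧸ Ideal.span {Prime.hypGerm L p F}) :=
  haveI := Prime.nontrivial_originStalk_quot L p hp F hF
  IsLocalRing.of_surjective' (Ideal.Quotient.mk (Ideal.span {Prime.hypGerm L p F})) Ideal.Quotient.mk_surjective

/-! ## §2 The prime dictionary and the stalks of `Spec (𝒪_{𝔸⁵,0} ⧸ (gₚ))` -/

/-- The pull-back to `𝒪_{𝔸⁵,0}` of a prime of `𝒪_{𝔸⁵,0} ⧸ (gₚ)` contains `gₚ`; hence `z^p + F` lies in the contraction
`Q ⊆ L[z,x]`. [folklore] -/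
theorem hyp_mem_under (F : MvPolynomial (Fin 4) L)
    (𝔮 : Ideal (originStalk L ⧸ Ideal.span {Prime.hypGerm L p F})) :
    hyp p F ∈ (𝔮.comap (Ideal.Quotient.mk (Ideal.span {Prime.hypGerm L p F}))).under (A 4 L) := by
  change Prime.hypGerm L p F ∈ 𝔮.comap (Ideal.Quotient.mk (Ideal.span {Prime.hypGerm L p F}))
  rw [Ideal.mem_comap, Ideal.Quotient.eq_zero_iff_mem.mpr (Ideal.subset_span (Set.mem_singleton _))]
  exact zero_mem _

/-- If the contraction is the origin, the point is the closed point. [cite: StacksProject, Tag 01J7] -/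
theorem eq_closedPoint_of_under_eq (hp : p ≠ 0) {F : MvPolynomial (Fin 4) L} (hF : MvPolynomial.constantCoeff F = 0)
    (𝔮 : Zs (originStalk L ⧸ Ideal.span {Prime.hypGerm L p F}))
    (h : (𝔮.asIdeal.comap (Ideal.Quotient.mk (Ideal.span {Prime.hypGerm L p F}))).under (A 4 L) = MvPolynomial.idealOfVars (Fin (4 + 1)) L) :
    haveI := isLocalRing_quot hp F hF
    𝔮 = closedPoint (originStalk L ⧸ Ideal.span {Prime.hypGerm L p F}) := by
  haveI := isLocalRing_quot hp F hF
  have h1 := Isolation.eq_maximalIdeal_of_under_eq _ h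
  have h2 : 𝔮.asIdeal = (maximalIdeal (originStalk L)).map (Ideal.Quotient.mk (Ideal.span {Prime.hypGerm L p F})) := by
    rw [← h1, Ideal.map_comap_of_surjective _ Ideal.Quotient.mk_surjective]
  have h3 : 𝔮.asIdeal.IsMaximal := by
    rcases Ideal.map_eq_top_or_isMaximal_of_surjective
        (Ideal.Quotient.mk (Ideal.span {Prime.hypGerm L p F}))
        Ideal.Quotient.mk_surjective (IsLocalRing.maximalIdeal.isMaximal (originStalk L)) with htop | hmax
    · exact absurd (h2.trans htop) Ideal.IsPrime.ne_top'
    · rwa [← h2] at hmax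
  exact PrimeSpectrum.ext (IsLocalRing.eq_maximalIdeal h3)

/-- The closed point contracts to the origin. [cite: StacksProject, Tag 01J7] -/
theorem under_closedPoint_eq (hp : p ≠ 0) {F : MvPolynomial (Fin 4) L} (hF : MvPolynomial.constantCoeff F = 0) :
    haveI := isLocalRing_quot hp F hF
    ((closedPoint (originStalk L ⧸ Ideal.span {Prime.hypGerm L p F})).asIdeal.comap
        (Ideal.Quotient.mk (Ideal.span {Prime.hypGerm L p F}))).under (A 4 L) = MvPolynomial.idealOfVars (Fin (4 + 1)) L := by
  haveI := isLocalRing_quot hp F hF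
  have h1 : (closedPoint (originStalk L ⧸ Ideal.span {Prime.hypGerm L p F})).asIdeal.comap
      (Ideal.Quotient.mk (Ideal.span {Prime.hypGerm L p F})) = maximalIdeal (originStalk L) := by
    haveI : (closedPoint (originStalk L ⧸ Ideal.span {Prime.hypGerm L p F})).asIdeal.IsMaximal :=
      IsLocalRing.maximalIdeal.isMaximal _
    haveI : ((closedPoint (originStalk L ⧸ Ideal.span {Prime.hypGerm L p F})).asIdeal.comap
        (Ideal.Quotient.mk (Ideal.span {Prime.hypGerm L p F}))).IsMaximal :=
      Ideal.comap_isMaximal_of_surjective _ Ideal.Quotient.mk_surjective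
    exact IsLocalRing.eq_maximalIdeal inferInstance
  rw [h1, IsLocalization.AtPrime.under_maximalIdeal (originStalk L) (ξ 4 L).asIdeal, Isolation.idealOfVars_eq_ξ]

/-- The extension of `(gₚ)` to `R_𝔮̃` is generated by the image of `z^p + F`. [folklore] -/
theorem map_span_germ (F : MvPolynomial (Fin 4) L) (𝔮 : Ideal (originStalk L)) [𝔮.IsPrime] :
    (Ideal.span {Prime.hypGerm L p F}).map
        (algebraMap (originStalk L) (Localization.AtPrime 𝔮)) =
      Ideal.span {algebraMap (A 4 L) (Localization.AtPrime 𝔮) (hyp p F)} := by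
  rw [Ideal.map_span, Set.image_singleton, ← IsScalarTower.algebraMap_apply]

/-- An `L[z,x]`-algebra isomorphism carries `(z^p + F)` to `(z^p + F)`. [folklore] -/
theorem span_algebraMap_hyp_eq_map (F : MvPolynomial (Fin 4) L) (𝔮 : Ideal (originStalk L)) [𝔮.IsPrime]
    (ε : Localization.AtPrime 𝔮 ≃ₐ[A 4 L] Localization.AtPrime (𝔮.under (A 4 L))) :
    Ideal.span {algebraMap (A 4 L) (Localization.AtPrime (𝔮.under (A 4 L))) (hyp p F)} =
      (Ideal.span {algebraMap (A 4 L) (Localization.AtPrime 𝔮) (hyp p F)}).map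
        (ε.toRingEquiv : Localization.AtPrime 𝔮 →+* Localization.AtPrime (𝔮.under (A 4 L))) := by
  rw [Ideal.map_span, Set.image_singleton]
  congr 2
  exact (ε.commutes (hyp p F)).symm

/-- **`𝒪_{Spec B, 𝔮} ≅ L[z,x]_Q ⧸ (z^p + F)`** for `B = 𝒪_{𝔸⁵,0} ⧸ (gₚ)`. [cite: StacksProject, Tag 01J7]
[cite: Matsumura1987, Thm. 4.1 (localisation of a localisation)] -/
theorem nonempty_stalk_ringEquiv (F : MvPolynomial (Fin 4) L)
    (𝔮 : Zs (originStalk L ⧸ Ideal.span {Prime.hypGerm L p F})) :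
    Nonempty (St (originStalk L ⧸ Ideal.span {Prime.hypGerm L p F}) 𝔮 ≃+*
      Localization.AtPrime ((𝔮.asIdeal.comap (Ideal.Quotient.mk (Ideal.span {Prime.hypGerm L p F}))).under (A 4 L)) ⧸
        Ideal.span {algebraMap (A 4 L)
          (Localization.AtPrime ((𝔮.asIdeal.comap
            (Ideal.Quotient.mk (Ideal.span {Prime.hypGerm L p F}))).under (A 4 L)))
          (hyp p F)}) := by
  obtain ⟨ε₁⟩ := Isolation.nonempty_stalk_ringEquiv_localization
    (originStalk L ⧸ Ideal.span {Prime.hypGerm L p F}) 𝔮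
  obtain ⟨ε₂⟩ := exists_ringEquiv_localization_quotient (Ideal.span {Prime.hypGerm L p F})
    𝔮.asIdeal (𝔮.asIdeal.comap (Ideal.Quotient.mk (Ideal.span {Prime.hypGerm L p F}))) rfl
  obtain ⟨ε₃⟩ := Isolation.nonempty_algEquiv_localization_under
    (𝔮.asIdeal.comap (Ideal.Quotient.mk (Ideal.span {Prime.hypGerm L p F})))
  have hI := map_span_germ (p := p) F
    (𝔮.asIdeal.comap (Ideal.Quotient.mk (Ideal.span {Prime.hypGerm L p F})))
  have hJ := span_algebraMap_hyp_eq_map (p := p) F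
    (𝔮.asIdeal.comap (Ideal.Quotient.mk (Ideal.span {Prime.hypGerm L p F}))) ε₃
  exact ⟨ε₁.trans (ε₂.symm.trans ((Ideal.quotEquivOfEq hI).trans (Ideal.quotientEquiv _ _ ε₃.toRingEquiv hJ)))⟩

/-! ## §3 Bennett at every point of `Spec (𝒪_{𝔸⁵,0} ⧸ (z^p + F))`, symbolic-order form -/

/-- **The Hilbert–Samuel function at a point `𝔮` of `Spec (𝒪_{𝔸⁵,0} ⧸ (z^p + F))` is the hypersurface function of the
symbolic order `m ∈ [1, p]` of `z^p + F` at the contracted prime** (`N ≥ 4`; ORDER CAP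
`SymbolicPower.hyp_not_mem_symbPow_succ`). [cite: CossartJannsenSaito2020, Def. 2.28, Thm. 2.3] -/
theorem exists_hsFun_eq (hp : p ≠ 0) (F : MvPolynomial (Fin 4) L)
    (𝔮 : Zs (originStalk L ⧸ Ideal.span {Prime.hypGerm L p F})) {N : ℕ} (hN : 4 ≤ N) :
    ∃ m : ℕ, Scheme.hsFun (Zs (originStalk L ⧸ Ideal.span {Prime.hypGerm L p F})) N 𝔮 =
        hypersurfaceHFe (N + 1) m ∧ m ≤ p ∧
      hyp p F ∈ HironakaScheme.symbPow L ((𝔮.asIdeal.comap (Ideal.Quotient.mk (Ideal.span {Prime.hypGerm L p F}))).under (A 4 L)) m ∧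
      hyp p F ∉ HironakaScheme.symbPow L ((𝔮.asIdeal.comap (Ideal.Quotient.mk (Ideal.span {Prime.hypGerm L p F}))).under (A 4 L)) (m + 1) := by
  classical
  set Q : Ideal (A 4 L) := (𝔮.asIdeal.comap
    (Ideal.Quotient.mk (Ideal.span {Prime.hypGerm L p F}))).under (A 4 L) with hQ
  obtain ⟨e, he5, he⟩ := Isolation.exists_ringKrullDim_eq Q (Isolation.under_le_idealOfVars _)
  obtain ⟨ε⟩ := nonempty_stalk_ringEquiv F 𝔮
  set g' : Localization.AtPrime Q := algebraMap (A 4 L) (Localization.AtPrime Q) (hyp p F) with hg'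
  have h1 : g' ∈ maximalIdeal (Localization.AtPrime Q) ^ 1 := by
    rw [pow_one]
    exact (IsLocalization.AtPrime.to_map_mem_maximal_iff (Localization.AtPrime Q) Q (hyp p F)).mpr
      (hyp_mem_under F 𝔮.asIdeal)
  have hcap : g' ∉ maximalIdeal (Localization.AtPrime Q) ^ (p + 1) := fun h =>
    SymbolicPower.hyp_not_mem_symbPow_succ hp F (Q := Q)
      ((Isolation.mem_symbPow_iff_algebraMap_mem Q (hyp p F) (p + 1)).mpr h)
  -- the order `m`: the least `k` with `g' ∉ 𝔪^(k+1)`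
  have hex : ∃ k, g' ∉ maximalIdeal (Localization.AtPrime Q) ^ (k + 1) := ⟨p, hcap⟩
  let m := Nat.find hex
  have hm_spec : g' ∉ maximalIdeal (Localization.AtPrime Q) ^ (m + 1) := Nat.find_spec hex
  have hm_le : m ≤ p := Nat.find_min' hex hcap
  have hm_pos : 1 ≤ m := by
    by_contra h0
    push Not at h0
    have hm0 : m = 0 := by omega
    have := hm_spec
    rw [hm0, zero_add] at this
    exact this h1
  have hgm : g' ∈ maximalIdeal (Localization.AtPrime Q) ^ m := by
    have h := Nat.find_min hex (show m - 1 < m by omega)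
    push Not at h
    rwa [Nat.sub_add_cancel hm_pos] at h
  refine ⟨m, ?_, hm_le, (Isolation.mem_symbPow_iff_algebraMap_mem Q (hyp p F) m).mpr hgm,
    fun h => hm_spec ((Isolation.mem_symbPow_iff_algebraMap_mem Q (hyp p F) (m + 1)).mp h)⟩
  exact hsFun_eq_hypersurfaceHFe_of_stalk_ringEquiv he (by omega) hm_pos hgm hm_spec ε

/-! ## §4 Row (I_p) -/

/-- **The closed point of `Spec (𝒪_{𝔸⁵,0} ⧸ (z^p + F))` is isolated in the Hilbert–Samuel locus** at every level `N ≥ 4`,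
when `ordZero F = p` (`p ≠ 0`) and the origin is an ISOLATED `p`-fold point (`IsIsolated p F`): the order profile of §3
peaks (value `p`) exactly at the closed point (`SymbolicPower.eq_idealOfVars_of_hyp_mem_symbPow`, every `p`).
[cite: CossartJannsenSaito2020, Def. 13.3] -/
theorem isIsolatedInHSMaxLocus_closedPoint (hp : p ≠ 0) {F : MvPolynomial (Fin 4) L} (hF : ordZero F = (p : ℕ∞))
    (hiso : IsIsolated p F) {N : ℕ} (hN : 4 ≤ N) :
    haveI := isLocalRing_quot hp F (Prime.constantCoeff_eq_zero_of_ordZero_eq hp hF)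
    IsIsolatedInHSMaxLocus (Zs (originStalk L ⧸ Ideal.span {Prime.hypGerm L p F})) N
      (closedPoint (originStalk L ⧸ Ideal.span {Prime.hypGerm L p F})) := by
  have hF0 := Prime.constantCoeff_eq_zero_of_ordZero_eq hp hF
  haveI := isLocalRing_quot hp F hF0
  choose m hm hmp hsymb hsymb' using fun 𝔮 => exists_hsFun_eq hp F 𝔮 hN
  have hm0 : m (closedPoint _) = p := by
    refine le_antisymm (hmp _) ?_
    by_contra hlt
    push Not at hlt
    have h3 : hyp p F ∈ HironakaScheme.symbPow L (MvPolynomial.idealOfVars (Fin (4 + 1)) L) p :=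
      SymbolicPower.hyp_mem_symbPow_idealOfVars (by rw [hF])
    have hne := hsymb' (closedPoint _)
    rw [under_closedPoint_eq hp hF0] at hne
    exact hne (HironakaScheme.symbPow_mono (by omega) h3)
  refine Isolation.isIsolatedInHSMaxLocus_of_profile m hm (fun 𝔮 => (hmp 𝔮).trans_eq hm0.symm) fun 𝔮 h𝔮 => ?_
  rw [hm0] at h𝔮
  have h3 := hsymb 𝔮
  rw [h𝔮] at h3
  exact eq_closedPoint_of_under_eq hp hF0 𝔮
    (SymbolicPower.eq_idealOfVars_of_hyp_mem_symbPow hp hF0 hiso (Isolation.under_le_idealOfVars _) h3)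

/-- **ROW (I_p), δ-UNFOLDED.**  For every field `L`, every `p ≠ 0`, `F` with `ordZero F = p` and `IsIsolated p F`, and
every scheme `S` LOCAL at `s` whose local ring is `𝒪_{𝔸⁵_L,0} ⧸ (z^p + F)`: the point `s` is isolated in the
Hilbert–Samuel locus of `S` at every level `N ≥ 4`.  No characteristic, no primality, no perfectness.
[OURS · row I_p of the p-program] [cite: CossartJannsenSaito2020, Def. 13.3, p. 107] -/
theorem isolationRowP_unfolded (hp : p ≠ 0) {F : MvPolynomial (Fin 4) L} (hF : ordZero F = (p : ℕ∞))
    (hiso : IsIsolated p F) {S : Scheme.{0}} [IsLocallyNoetherian S] {s : S} (hloc : IsLocalAt S s)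
    (hpres : Nonempty (S.presheaf.stalk s ≃+* originStalk L ⧸ Ideal.span {Prime.hypGerm L p F}))
    {N : ℕ} (hN : 4 ≤ N) : IsIsolatedInHSMaxLocus S N s := by
  have hF0 := Prime.constantCoeff_eq_zero_of_ordZero_eq hp hF
  haveI := isLocalRing_quot hp F hF0
  obtain ⟨e⟩ := hpres
  haveI : IsIso (S.fromSpecStalk s) := hloc
  let φ : CommRingCat.of (originStalk L ⧸ Ideal.span {Prime.hypGerm L p F}) ⟶
      S.presheaf.stalk s := CommRingCat.ofHom e.symm.toRingHom
  haveI : IsIso φ := by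
    change IsIso e.symm.toCommRingCatIso.hom
    infer_instance
  let f : S ⟶ Zs (originStalk L ⧸ Ideal.span {Prime.hypGerm L p F}) :=
    inv (S.fromSpecStalk s) ≫ Spec.map φ
  refine isIsolatedInHSMaxLocus_of_iso f ?_
  have hfs : f.base s = closedPoint (originStalk L ⧸ Ideal.span {Prime.hypGerm L p F}) := by
    have hbij : Function.Bijective f.base := ConcreteCategory.bijective_of_isIso f.base
    obtain ⟨η, hη⟩ := hbij.2 (closedPoint _)
    have hsp : f.base η ⤳ f.base s := (specializes_of_isLocalAt hloc η).map f.base.hom.continuous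
    rw [hη] at hsp
    have hcl : IsClosed ({closedPoint (originStalk L ⧸ Ideal.span {Prime.hypGerm L p F})} :
        Set (Zs (originStalk L ⧸ Ideal.span {Prime.hypGerm L p F}))) :=
      (PrimeSpectrum.isClosed_singleton_iff_isMaximal _).mpr (IsLocalRing.maximalIdeal.isMaximal _)
    have hmem : f.base s ∈ closure {closedPoint (originStalk L ⧸ Ideal.span {Prime.hypGerm L p F})} :=
      specializes_iff_mem_closure.mp hsp
    exact hcl.closure_subset_iff.mpr subset_rfl hmem
  rw [hfs]
  exact isIsolatedInHSMaxLocus_closedPoint hp hF hiso hN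

end IsolationP

/-- **ROW (I_p) BY NAME — `IsolationRowP p` (res-dim4-p-3 g2's `…E2OfCJSRowsPrime`) for every prime `p`.** The row's
binders `[CharP L p]`, `[PerfectField L]` are not used; `PresentedByP` is bridged to `𝒪_{𝔸⁵,0} ⧸ (gₚ)` by
res-dim4-p-2 g2's `Prime.hypStalkEquivQuot`. [OURS · row I_p of the p-program · counted 0]
[cite: CossartJannsenSaito2020, Def. 13.3, p. 107] -/
theorem isolationRowP (p : ℕ) [hp : Fact p.Prime] : IsolationRowP p := by
  intro L _ _ _ F hF hiso S _ s hloc hpres N hN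
  obtain ⟨e⟩ := hpres
  exact IsolationP.isolationRowP_unfolded hp.out.ne_zero hF hiso hloc
    ⟨e.commRingCatIsoToRingEquiv.trans (Prime.hypStalkEquivQuot L p F)⟩ (le_trans (by norm_num) hN)

end E2OfCJS

end Summit.ResolutionOfSingularities.ResolutionOfSingularities.Theorems.PIDim4

end
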